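import Summits.QuantumFields.YangMills.Theorems.TwistedTraceScaling.Negative.FPWeightMustPinColour
import Summits.QuantumFields.YangMills.Theorems.LuscherReductionOneSiteLevelsNormaliser
import Summits.QuantumFields.YangMills.Theorems.FemtoTransferGapRungW1upSite
import HarnessLib

/-!
# R38b — the LOCALITY door does not rescue a colour-invariant Faddeev–Popov weight: the tail budget `τ ≤ κ₂·C·λ₀(1, L³β)` of `hT_of_fp_add` is `B^{-9/2}`-small against
# the diagonal value `C·K₁(u_θ,u_θ) = C·e^{6B}` that the Weyl flip has to move
(crux `LuscherReduction.TwistedTraceScaling`, stmt-QuantumFields-20203; standing disprover, cycle 30; vets lane A g14's p657326 `…BTPointwiseTail` (`hT_of_fp_add`), p656382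
`…BTColourMean`, p656602 `…BTFibreProfile`, p656825 `…BTTubeKinetic`, p657634 `…BTGaugeKinetic` and COARSE-DESIGN §25.6–§25.7)

VETTED: `hT_of_fp_add` — (B-T) ⟸ `∀ᶠ β, ∀ u u' ∈ window: |fpBOKernel − C·K₁^{(L³β)}| ≤ κ·C·K₁^{(L³β)} + τ` (RELATIVE on the window, ABSOLUTE tail `τ`) with the tail budget
`τ/Z ≤ κ₂·(C/Z)·λ₀(1, L³β)` and `0 ≤ κ`; exact (Jensen `(∫|φ|)² ≤ ∫φ²` turns `τ` into `τ‖φ‖²`).  SOUND.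
FINDING (load-bearing analysis, kernel-checked): the absolute tail does NOT re-admit colour-invariant weights.  `transferKernel_diag_self`: the RAW one-site kernel on the diagonal
of a one-site flip datum is `K₁^{(B)}(u_θ, u_θ) = e^{6B}` (zero magnetic energy, full electric alignment), while `levelValue_one_zero_le`: `λ₀(1,B) ≤ linkC(B)³ ≤ e^{6B}/B` for
`B ≥ π` (Schur bound `topValue_le_linkCE` + the Gaussian one-link bound `linkC_le_gauss`); so the admissible tail is `τ ≤ κ₂·C·e^{6B}/B`, i.e. `B⁻¹`-small in units of the diagonal.
★★ `flip_constraint_of_hptAdd`: for a LEFT-COLOUR-INVARIANT `W` and colour-blind `Ω`, `hpt_add` on `{orbitDist < δ}` with `C > 0` forces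
`(1 − κ)·e^{6B} ≤ (1 + κ)·e^{−B(2−2cos 2θ)|Edge 3 1|}·e^{6B} + 2τ/C` at every flip pair in the window; ★★★ `not_hptAdd_of_colourInvariant`: with `0 ≤ s < 1/2`, eventual `C β > 0`,
`0 ≤ κ β ≤ κ₀ < 1`, `κ₂ β ≤ K₂`, `Z β > 0` and lane A's tail budget, the `∀ᶠ β` hypothesis `hpt` of `hT_of_fp_add` is FALSE for every such `W β` — in particular (★★★
`not_hptAdd_trivial_weight`) for `W ≡ 1`, i.e. for `𝒦_β` itself (`R38.boKernel_eq_fpBOKernel_one`).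
READING (no kill): as in R38 the pin is the load-bearing content of `W`; the locality door's tail is sized for FAR pairs (both kernels `≤ e^{6B − c log²β}`) and is `B^{−1}`-negligible
where the flip bites (the diagonal), so it changes nothing for colour-invariant weights.  Lane A's pinned weight `fpWeight β⁻¹` is untouched; §25.6 (L1) — the colour-pinned
coercivity `TC(orthoTube u v, g·orthoTube u' v') ≤ 2|E| − c_L max_k|a⃗_k|² + C(ε + r)` — passes the disprover's quadratic-order test (the cross term is EXACTLY F1b's pinned colour sum
`−2Σ_k(Σ_x g⃗_x)·(u⃗_k × u⃗'_k)`; re-aligning gauge copies pay domain walls `≥ cBν^{2/3}L²` against gains `≤ 4νL³Bδ₁²`), and §25.7's pointwise Haar average `∫_c Ad_c a dc = 0` is exact.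
HONEST FRAMING: symmetry bookkeeping + the Schur/Gaussian bound on `λ₀(1,B)`, about the typed hypotheses of lane A's own reduction for stub S-BASE/C4-CORE of a child of the CONDITIONAL
reduction route R2b1 (`LuscherReduction`); no registered statement refuted or proved; the Laplace core of (B-T) and C4 are OPEN; not infinite volume, not a gap, not Clay.

## References
* I. Montvay, G. Münster, *Quantum Fields on a Lattice*, CUP (1994), §3.2.3 (3.96)–(3.97) p. 121 (one-link integrals of `SU(2)`, `∫e^{B Re tr W}dW = I₁(4B)/(2B)… ≤ e^{2B}(π/B)^{3/2}/(2π²)`). [MontvayMunster1994]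
* M. Reed, B. Simon, *Methods of Modern Mathematical Physics IV*, Academic Press (1978), Thm. XIII.1 (min–max; `λ₀ ≤` Schur row sum). [ReedSimonIV1978]
* E. Seiler, *Gauge Theories as a Problem of Constructive Quantum Field Theory and Statistical Mechanics*, LNP 159 (1982), §3 (transfer matrix, gauge averaging). [SeilerLNP1982]
-/

set_option autoImplicit false

noncomputable section

open MeasureTheory Real Filter Topology
open scoped BigOperators
open Literature.MathematicalPhysics.QuantumFieldTheory hiding SU2
open Literature.MathematicalPhysics.QuantumLattice

namespace Summit.QuantumFields.YangMills.Theorems.TwistedTraceScaling.Negative.R38b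

open Summit.QuantumFields.YangMills.Theorems.FemtoTransferGap
open Summit.QuantumFields.YangMills.Theorems.FemtoTransferGap.TwoLattice.Avg
open Summit.QuantumFields.YangMills.Theorems.FemtoTransferGap.TwoLattice.ConstTube
open Summit.QuantumFields.YangMills.Theorems.FemtoTransferGap.TwoLattice.Stiff (LinkSpace)
open Summit.QuantumFields.YangMills.Theorems.TwistedTraceScaling.Negative.R32 (sq_le_two_sub_two_cos_two_mul)
open Summit.QuantumFields.YangMills.Theorems.TwistedTraceScaling.Negative.R38 (fpBOKernel_conj_left boKernel_eq_fpBOKernel_one orbitDist_uDiag_le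
  exists_uDiag_neg_eq_conj transferKernel_uDiag_flip)

variable {L : ℕ} [NeZero L]

/-! ## §1 The diagonal value of the raw one-site kernel and the Schur–Gauss ceiling of `λ₀(1,B)` -/

/-- `K₁^{(B)}(u, u) = e^{6B}` for the one-site datum `u = (d, d, d)` (all links equal: every plaquette commutator is `1`, every electric term is `Re tr 1 = 2`). [cite: SeilerLNP1982, §3] -/
theorem transferKernel_diag_self (B : ℝ) (d : SU2) :
    transferKernel su2Rep B (fun _ : Edge 3 1 => d) (fun _ : Edge 3 1 => d) = Real.exp (6 * B) := by
  have hS : wilsonAction su2Rep (fun _ : Edge 3 1 => d) = 0 := by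
    rw [wilsonAction_one_site]
    refine Finset.sum_eq_zero fun p _ => ?_
    have h1 : d * d * d⁻¹ * d⁻¹ = 1 := by group
    rw [h1]
    simp
  have hT : timeCoupling su2Rep (fun _ : Edge 3 1 => d) (fun _ : Edge 3 1 => d) = 6 := by
    unfold timeCoupling
    simp only [mul_inv_cancel, map_one, Matrix.trace_one, Fintype.card_fin]
    rw [Finset.sum_const, Finset.card_univ, nsmul_eq_mul]
    have hcard : (Fintype.card (Edge 3 1) : ℝ) = 3 := by
      rw [Summit.QuantumFields.YangMills.Theorems.TwistedTraceScaling.Negative.R36.card_edge_eq]; simp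
    norm_num [hcard]
  unfold transferKernel
  rw [hT, hS]
  congr 1; ring

/-- **`λ₀(1,B) ≤ e^{6B}/B` for `B ≥ π`** (Schur: `λ₀ ≤ linkC(B)^{|E|}`, `linkC(B) ≤ e^{2B}(π/B)^{3/2}/(2π²) ≤ e^{2B}/B`). [cite: MontvayMunster1994, §3.2.3 (3.97) p.121] -/
theorem levelValue_one_zero_le {B : ℝ} (hB : π ≤ B) : levelValue su2Rep 1 B 0 ≤ Real.exp (6 * B) / B := by
  have hπ := Real.pi_pos
  have hB0 : 0 < B := hπ.trans_le hB
  have h3 : 3 < π := Real.pi_gt_three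
  have hB1 : 1 ≤ B := by linarith
  have hlink : linkC B ≤ Real.exp (2 * B) / B := by
    refine (linkC_le_gauss hB0).trans ?_
    have hq : π / B ≤ 1 := (div_le_one hB0).mpr hB
    have hq0 : 0 ≤ π / B := by positivity
    have hs1 : Real.sqrt (π / B) ≤ 1 := Real.sqrt_le_one.mpr hq
    have hs0 : 0 ≤ Real.sqrt (π / B) := Real.sqrt_nonneg _
    have hsq : Real.sqrt (π / B) ^ 2 = π / B := Real.sq_sqrt hq0
    have hcube : Real.sqrt (π / B) ^ 3 ≤ π / B := by
      calc Real.sqrt (π / B) ^ 3 = Real.sqrt (π / B) ^ 2 * Real.sqrt (π / B) := by ring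
        _ ≤ Real.sqrt (π / B) ^ 2 * 1 := mul_le_mul_of_nonneg_left hs1 (sq_nonneg _)
        _ = π / B := by rw [mul_one, hsq]
    have hden : (1 : ℝ) ≤ 2 * π ^ 2 := by nlinarith
    calc Real.exp (2 * B) * Real.sqrt (π / B) ^ 3 / (2 * π ^ 2)
        ≤ Real.exp (2 * B) * (π / B) / (2 * π ^ 2) := by gcongr
      _ = Real.exp (2 * B) / B * (π / (2 * π ^ 2)) := by field_simp
      _ ≤ Real.exp (2 * B) / B * 1 := by
          refine mul_le_mul_of_nonneg_left ?_ (by positivity)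
          rw [div_le_one (by positivity)]; nlinarith
      _ = Real.exp (2 * B) / B := mul_one _
  have hC0 : 0 ≤ linkC B := (linkC_pos hB0.le).le
  have htop : levelValue su2Rep 1 B 0 ≤ linkC B ^ 3 := by
    rw [levelValue_zero]
    refine (topValue_le_linkCE hB0.le).trans (le_of_eq ?_)
    unfold linkCE
    have hcard : Fintype.card (Edge 3 1) = 3 := by
      have h := Summit.QuantumFields.YangMills.Theorems.TwistedTraceScaling.Negative.R36.card_edge_eq (L := 1)
      have h1 : (3 : ℝ) * Fintype.card (Site 3 1) = 3 := by simp
      rw [h1] at h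
      exact_mod_cast h
    rw [hcard]
  refine htop.trans ?_
  calc linkC B ^ 3 ≤ (Real.exp (2 * B) / B) ^ 3 := by gcongr
    _ = Real.exp (6 * B) / B ^ 3 := by rw [div_pow, ← Real.exp_nat_mul]; ring_nf
    _ ≤ Real.exp (6 * B) / B := by
        refine div_le_div_of_nonneg_left (Real.exp_pos _).le hB0 ?_
        calc B = B * 1 * 1 := by ring
          _ ≤ B * B * B := by gcongr
          _ = B ^ 3 := by ring

/-! ## §2 ★★ The flip constraint with an absolute tail -/

/-- ★★ **The flip constraint, relative-plus-absolute version.**  For left-colour-invariant `W`, colour-blind `Ω`, `C > 0` and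
`hpt_add : |fpBOKernel − C·K₁^{(B)}| ≤ κ·C·K₁^{(B)} + τ` on `{orbitDist < δ}`: at every angle with `3√2|θ| < δ`,
`(1 − κ)·e^{6B} ≤ (1 + κ)·e^{−B(2−2cos 2θ)|Edge 3 1|}·e^{6B} + 2τ/C`. [cite: SeilerLNP1982, §3] -/
theorem flip_constraint_of_hptAdd (β B : ℝ) {Ω : LinkSpace L → ℝ} (hΩm : Measurable Ω) (hΩinv : ∀ (g : SU2) (x : LinkSpace L), Ω (adL L g x) = Ω x)
    {W : (Site 3 L → SU2) → ℝ} (hW : Measurable W) (hWinv : ∀ (c : SU2) (g : Site 3 L → SU2), W (fun x => c * g x) = W g)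
    {C κ τ δ : ℝ} (hC : 0 < C)
    (hpt : ∀ u u' : GaugeConfig 3 1 SU2, orbitDist u < δ → orbitDist u' < δ →
      |fpBOKernel L β Ω W u u' - C * transferKernel su2Rep B u u'| ≤ κ * C * transferKernel su2Rep B u u' + τ)
    {θ : ℝ} (hθ : 3 * Real.sqrt 2 * |θ| < δ) :
    (1 - κ) * Real.exp (6 * B) ≤ (1 + κ) * Real.exp (-(B * (2 - 2 * Real.cos (2 * θ)) * Fintype.card (Edge 3 1))) * Real.exp (6 * B) + 2 * τ / C := by
  have hin : ∀ t : ℝ, |t| = |θ| → orbitDist (fun _ : Edge 3 1 => diagSU2 t) < δ := fun t ht =>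
    (orbitDist_uDiag_le t).trans_lt (by rw [ht]; exact hθ)
  have hθin := hin θ rfl
  have hθin' := hin (-θ) (abs_neg θ)
  have hK : transferKernel su2Rep B (fun _ : Edge 3 1 => diagSU2 θ) (fun _ : Edge 3 1 => diagSU2 θ) = Real.exp (6 * B) := transferKernel_diag_self B _
  set E : ℝ := Real.exp (-(B * (2 - 2 * Real.cos (2 * θ)) * Fintype.card (Edge 3 1))) with hE
  have h1 := hpt _ _ hθin hθin
  have h2 := hpt _ _ hθin' hθin
  obtain ⟨Wf, hWf⟩ := exists_uDiag_neg_eq_conj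
  have hsame : fpBOKernel L β Ω W (fun _ : Edge 3 1 => diagSU2 (-θ)) (fun _ : Edge 3 1 => diagSU2 θ) =
      fpBOKernel L β Ω W (fun _ : Edge 3 1 => diagSU2 θ) (fun _ : Edge 3 1 => diagSU2 θ) := by
    rw [hWf θ]; exact fpBOKernel_conj_left β hΩm hΩinv hW hWinv Wf _ _
  have hflip : transferKernel su2Rep B (fun _ : Edge 3 1 => diagSU2 (-θ)) (fun _ : Edge 3 1 => diagSU2 θ) = E * Real.exp (6 * B) := by
    rw [hE, ← hK]; exact transferKernel_uDiag_flip B θ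
  rw [hK] at h1
  rw [hsame, hflip] at h2
  have hlow := (abs_le.mp h1).1
  have hup := (abs_le.mp h2).2
  -- `(1-κ) C e^{6B} - τ ≤ fpBO ≤ (1+κ) C E e^{6B} + τ`
  have key : (1 - κ) * Real.exp (6 * B) * C ≤ (1 + κ) * E * Real.exp (6 * B) * C + 2 * τ := by linarith
  have hdiv : (1 - κ) * Real.exp (6 * B) ≤ ((1 + κ) * E * Real.exp (6 * B) * C + 2 * τ) / C := by
    rw [le_div_iff₀ hC]; exact key
  rwa [add_div, mul_div_cancel_right₀ _ hC.ne'] at hdiv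

/-! ## §3 ★★★ `hpt` of `hT_of_fp_add` is unsatisfiable for colour-invariant weights under lane A's tail budget -/

/-- ★★★ **NO colour-invariant FP weight through the locality door either.**  For `0 ≤ s < 1/2`, colour-blind measurable `Ω β`, measurable LEFT-COLOUR-INVARIANT `W β`, eventual
`C β > 0`, `0 ≤ κ β ≤ κ₀ < 1`, `κ₂ β ≤ K₂`, `Z β > 0` and lane A's tail budget `τ β/Z β ≤ κ₂ β·(C β/Z β)·λ₀(1, L³β)`, the `∀ᶠ β` hypothesis `hpt` of `hT_of_fp_add` is FALSE
(`θ_β = β^{−s}/|Site|`; the flip deficit `(1−κ₀) − 2e^{−L³β^{1−2s}/|Site|²}` must be `≤ 2κ₂λ₀(1,B)e^{−6B} ≤ 2K₂/B → 0`). [cite: MontvayMunster1994, §3.2.3 (3.97) p.121] -/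
theorem not_hptAdd_of_colourInvariant {s : ℝ} (hs0 : 0 ≤ s) (hs : s < 1 / 2) {Ω : ℝ → LinkSpace L → ℝ} (hΩm : ∀ β, Measurable (Ω β))
    (hΩinv : ∀ β (g : SU2) (x : LinkSpace L), Ω β (adL L g x) = Ω β x)
    {W : ℝ → (Site 3 L → SU2) → ℝ} (hW : ∀ β, Measurable (W β)) (hWinv : ∀ β (c : SU2) (g : Site 3 L → SU2), W β (fun x => c * g x) = W β g)
    {C κ κ₂ τ Z : ℝ → ℝ} (hC : ∀ᶠ β : ℝ in atTop, 0 < C β) (hκ0 : ∀ᶠ β : ℝ in atTop, 0 ≤ κ β) {κ₀ : ℝ} (hκ₀ : κ₀ < 1) (hκ : ∀ᶠ β : ℝ in atTop, κ β ≤ κ₀)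
    {K₂ : ℝ} (hκ₂ : ∀ᶠ β : ℝ in atTop, κ₂ β ≤ K₂) (hZ0 : ∀ β, 0 < Z β)
    (hτZ : ∀ᶠ β : ℝ in atTop, τ β / Z β ≤ κ₂ β * (C β / Z β) * levelValue su2Rep 1 ((L : ℝ) ^ 3 * β) 0) :
    ¬ (∀ᶠ β : ℝ in atTop, ∀ u u' : GaugeConfig 3 1 SU2, orbitDist u < recordDelta1 L s β → orbitDist u' < recordDelta1 L s β →
      |fpBOKernel L β (Ω β) (W β) u u' - C β * transferKernel su2Rep ((L : ℝ) ^ 3 * β) u u'| ≤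
        κ β * C β * transferKernel su2Rep ((L : ℝ) ^ 3 * β) u u' + τ β) := by
  intro hpt
  set N : ℝ := (Fintype.card (Site 3 L) : ℝ) with hN
  have hN0 : 0 < N := by rw [hN]; exact_mod_cast Fintype.card_pos
  have hN1 : 1 ≤ N := by rw [hN]; exact_mod_cast Fintype.card_pos
  have hL1 : (1 : ℝ) ≤ (L : ℝ) := by exact_mod_cast Nat.one_le_iff_ne_zero.mpr (NeZero.ne L)
  have hL3 : (1 : ℝ) ≤ (L : ℝ) ^ 3 := one_le_pow₀ hL1
  have hq : 0 < 1 - 2 * s := by linarith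
  have hgap : 0 < 1 - κ₀ := by linarith
  set K : ℝ := max K₂ 0 with hKdef
  have hK0 : 0 ≤ K := le_max_right _ _
  -- thresholds: `β ≥ π` (so `B ≥ π`), `β ≥ 8K/(1-κ₀)` (tail), `β^{1-2s} ≥ T` (flip)
  set T : ℝ := N ^ 2 * (max (Real.log (4 / (1 - κ₀))) 0 + 1) with hT
  have hT0 : 0 < T := by positivity
  obtain ⟨β₀, hβ₀⟩ := rpow_neg_eventually_le hq (inv_pos.mpr hT0)
  obtain ⟨β, hβpt, hCβ, hκ0β, hκβ, hκ₂β, hτβ, hββ₀, hβπ, hβK⟩ :=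
    (hpt.and (hC.and (hκ0.and (hκ.and (hκ₂.and (hτZ.and ((eventually_ge_atTop β₀).and
      ((eventually_ge_atTop π).and (eventually_ge_atTop (8 * K / (1 - κ₀))))))))))).exists
  obtain ⟨hβ1, hβT⟩ := hβ₀ β hββ₀
  have hβ0 : 0 < β := by linarith
  set B : ℝ := (L : ℝ) ^ 3 * β with hB
  have hBβ : β ≤ B := le_mul_of_one_le_left hβ0.le hL3
  have hBπ : π ≤ B := hβπ.trans hBβ
  have hB0 : 0 < B := Real.pi_pos.trans_le hBπ
  -- the tail in units of the diagonal: `2τ/C ≤ 2K e^{6B}/B`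
  have hτ : τ β ≤ κ₂ β * C β * levelValue su2Rep 1 B 0 := by
    have h := mul_le_mul_of_nonneg_left hτβ (hZ0 β).le
    have e1 : Z β * (τ β / Z β) = τ β := mul_div_cancel₀ _ (hZ0 β).ne'
    have e2 : Z β * (κ₂ β * (C β / Z β) * levelValue su2Rep 1 B 0) = κ₂ β * C β * levelValue su2Rep 1 B 0 := by
      calc Z β * (κ₂ β * (C β / Z β) * levelValue su2Rep 1 B 0) = κ₂ β * (Z β * (C β / Z β)) * levelValue su2Rep 1 B 0 := by ring
        _ = κ₂ β * C β * levelValue su2Rep 1 B 0 := by rw [mul_div_cancel₀ _ (hZ0 β).ne']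
    rwa [e1, e2] at h
  have hlv0 : 0 ≤ levelValue su2Rep 1 B 0 := (levelValue_zero_su2Rep_pos 1 B).le
  have hτ' : 2 * τ β / C β ≤ 2 * K * (Real.exp (6 * B) / B) := by
    rw [div_le_iff₀ hCβ]
    have h1 : κ₂ β * C β * levelValue su2Rep 1 B 0 ≤ K * C β * (Real.exp (6 * B) / B) := by
      calc κ₂ β * C β * levelValue su2Rep 1 B 0 ≤ K * C β * levelValue su2Rep 1 B 0 :=
            mul_le_mul_of_nonneg_right (mul_le_mul_of_nonneg_right (hκ₂β.trans (le_max_left _ _)) hCβ.le) hlv0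
        _ ≤ K * C β * (Real.exp (6 * B) / B) := mul_le_mul_of_nonneg_left (levelValue_one_zero_le hBπ) (mul_nonneg hK0 hCβ.le)
    nlinarith
  -- the angle and the window
  have hδ : powScale s β = β ^ (-s) := powScale_eq hβ1
  have hδ0 : 0 < powScale s β := powScale_pos s β
  have hδ1 : powScale s β ≤ 1 := powScale_le_one hs0 β
  set θ : ℝ := powScale s β / N with hθ
  have hθ0 : 0 < θ := by positivity
  have hθle1 : θ ≤ 1 := by rw [hθ, div_le_one hN0]; exact hδ1.trans hN1
  have hθpi : θ ≤ π / 2 := by linarith [Real.pi_gt_three]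
  have hs2 : Real.sqrt 2 < 2 := (Real.sqrt_lt' (by norm_num)).mpr (by norm_num)
  have hwin : 3 * Real.sqrt 2 * |θ| < recordDelta1 L s β := by
    rw [abs_of_pos hθ0, hθ]
    unfold recordDelta1
    rw [← hN, show 3 * Real.sqrt 2 * (powScale s β / N) = (3 * Real.sqrt 2) * powScale s β / N by ring]
    exact div_lt_div_of_pos_right (by nlinarith) hN0
  have hcon := flip_constraint_of_hptAdd (L := L) β B (hΩm β) (hΩinv β) (hW β) (hWinv β) hCβ hβpt hwin
  -- the flip factor is small: `E ≤ e^{-Bθ²}` and `Bθ² ≥ log(4/(1-κ₀)) + 1`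
  have hE : Real.exp (-(B * (2 - 2 * Real.cos (2 * θ)) * Fintype.card (Edge 3 1))) ≤ Real.exp (-(B * θ ^ 2)) := by
    rw [Real.exp_le_exp, neg_le_neg_iff]
    have hkin : θ ^ 2 ≤ 2 - 2 * Real.cos (2 * θ) := sq_le_two_sub_two_cos_two_mul hθ0.le hθpi
    have hcard : (1 : ℝ) ≤ Fintype.card (Edge 3 1) := by exact_mod_cast Fintype.card_pos
    have hk0 : 0 ≤ B * (2 - 2 * Real.cos (2 * θ)) := mul_nonneg hB0.le ((sq_nonneg θ).trans hkin)
    calc B * θ ^ 2 ≤ B * (2 - 2 * Real.cos (2 * θ)) := mul_le_mul_of_nonneg_left hkin hB0.le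
      _ = B * (2 - 2 * Real.cos (2 * θ)) * 1 := (mul_one _).symm
      _ ≤ B * (2 - 2 * Real.cos (2 * θ)) * Fintype.card (Edge 3 1) := mul_le_mul_of_nonneg_left hcard hk0
  have hpow : T ≤ β ^ (1 - 2 * s) := by
    have h := hβT
    rw [Real.rpow_neg hβ0.le] at h
    rwa [inv_le_inv₀ (Real.rpow_pos_of_pos hβ0 _) hT0] at h
  have hβθ : B * θ ^ 2 = (L : ℝ) ^ 3 * (β ^ (1 - 2 * s) / N ^ 2) := by
    rw [hB, hθ, hδ, div_pow, ← Real.rpow_natCast (β ^ (-s)) 2, ← Real.rpow_mul hβ0.le]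
    have e : β ^ (1 - 2 * s) = β * β ^ (-s * ((2 : ℕ) : ℝ)) := by
      rw [show (1 : ℝ) - 2 * s = 1 + -s * ((2 : ℕ) : ℝ) by push_cast; ring, Real.rpow_add hβ0, Real.rpow_one]
    rw [e]; ring
  have hX : max (Real.log (4 / (1 - κ₀))) 0 + 1 ≤ B * θ ^ 2 := by
    rw [hβθ]
    have h1 : T / N ^ 2 ≤ β ^ (1 - 2 * s) / N ^ 2 := div_le_div_of_nonneg_right hpow (by positivity)
    have h2 : T / N ^ 2 = max (Real.log (4 / (1 - κ₀))) 0 + 1 := by rw [hT]; field_simp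
    have h3 : β ^ (1 - 2 * s) / N ^ 2 ≤ (L : ℝ) ^ 3 * (β ^ (1 - 2 * s) / N ^ 2) :=
      le_mul_of_one_le_left (div_nonneg (Real.rpow_nonneg hβ0.le _) (by positivity)) hL3
    linarith
  have hflip : 2 * Real.exp (-(B * θ ^ 2)) < (1 - κ₀) / 2 := by
    have hlog : Real.log (4 / (1 - κ₀)) < B * θ ^ 2 := by
      have := le_max_left (Real.log (4 / (1 - κ₀))) 0; linarith
    have h2 : 4 / (1 - κ₀) < Real.exp (B * θ ^ 2) := by
      rw [← Real.exp_log (show 0 < 4 / (1 - κ₀) by positivity)]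
      exact Real.exp_lt_exp.mpr hlog
    rw [Real.exp_neg]
    have hpos : 0 < Real.exp (B * θ ^ 2) := Real.exp_pos _
    rw [div_lt_iff₀ hgap] at h2
    rw [mul_inv_lt_iff₀ hpos]
    linarith
  -- the tail is small: `2K/B ≤ (1-κ₀)/4`
  have htail : 2 * K / B ≤ (1 - κ₀) / 4 := by
    rw [div_le_iff₀ hB0]
    have h1 : 8 * K / (1 - κ₀) ≤ B := hβK.trans hBβ
    rw [div_le_iff₀ hgap] at h1
    linarith
  -- divide the flip constraint by `e^{6B}` and conclude
  have hexp : 0 < Real.exp (6 * B) := Real.exp_pos _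
  have h1 : (1 - κ β) ≤ (1 + κ β) * Real.exp (-(B * θ ^ 2)) + 2 * K / B := by
    have hA : (1 + κ β) * Real.exp (-(B * (2 - 2 * Real.cos (2 * θ)) * Fintype.card (Edge 3 1))) * Real.exp (6 * B) ≤
        (1 + κ β) * Real.exp (-(B * θ ^ 2)) * Real.exp (6 * B) :=
      mul_le_mul_of_nonneg_right (mul_le_mul_of_nonneg_left hE (by linarith)) hexp.le
    have hc : (1 - κ β) * Real.exp (6 * B) ≤ (1 + κ β) * Real.exp (-(B * θ ^ 2)) * Real.exp (6 * B) + 2 * K * (Real.exp (6 * B) / B) := by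
      linarith [hcon, hA, hτ']
    have e : (1 + κ β) * Real.exp (-(B * θ ^ 2)) * Real.exp (6 * B) + 2 * K * (Real.exp (6 * B) / B) =
        ((1 + κ β) * Real.exp (-(B * θ ^ 2)) + 2 * K / B) * Real.exp (6 * B) := by ring
    rw [e] at hc
    exact le_of_mul_le_mul_right hc hexp
  have h2 : (1 + κ β) * Real.exp (-(B * θ ^ 2)) ≤ 2 * Real.exp (-(B * θ ^ 2)) :=
    mul_le_mul_of_nonneg_right (by linarith) (Real.exp_pos _).le
  linarith

/-- ★★★ **In particular for the TRIVIAL weight**: `∀ᶠ β, ∀ u u' ∈ window: |𝒦_β − C β·K₁^{(L³β)}| ≤ κ β·C β·K₁^{(L³β)} + τ β` with lane A's tail budget, eventual `C β > 0`,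
`0 ≤ κ β ≤ κ₀ < 1`, `κ₂ β ≤ K₂`, is impossible for colour-blind bounded measurable `Ω β` (`0 ≤ s < 1/2`). [cite: SeilerLNP1982, §3] -/
theorem not_hptAdd_trivial_weight {s : ℝ} (hs0 : 0 ≤ s) (hs : s < 1 / 2) {Ω : ℝ → LinkSpace L → ℝ} (hΩm : ∀ β, Measurable (Ω β))
    {CΩ : ℝ → ℝ} (hCΩ : ∀ β x, |Ω β x| ≤ CΩ β) (hΩinv : ∀ β (g : SU2) (x : LinkSpace L), Ω β (adL L g x) = Ω β x)
    {C κ κ₂ τ Z : ℝ → ℝ} (hC : ∀ᶠ β : ℝ in atTop, 0 < C β) (hκ0 : ∀ᶠ β : ℝ in atTop, 0 ≤ κ β) {κ₀ : ℝ} (hκ₀ : κ₀ < 1) (hκ : ∀ᶠ β : ℝ in atTop, κ β ≤ κ₀)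
    {K₂ : ℝ} (hκ₂ : ∀ᶠ β : ℝ in atTop, κ₂ β ≤ K₂) (hZ0 : ∀ β, 0 < Z β)
    (hτZ : ∀ᶠ β : ℝ in atTop, τ β / Z β ≤ κ₂ β * (C β / Z β) * levelValue su2Rep 1 ((L : ℝ) ^ 3 * β) 0) :
    ¬ (∀ᶠ β : ℝ in atTop, ∀ u u' : GaugeConfig 3 1 SU2, orbitDist u < recordDelta1 L s β → orbitDist u' < recordDelta1 L s β →
      |boKernel L β (Ω β) u u' - C β * transferKernel su2Rep ((L : ℝ) ^ 3 * β) u u'| ≤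
        κ β * C β * transferKernel su2Rep ((L : ℝ) ^ 3 * β) u u' + τ β) := by
  intro h
  refine not_hptAdd_of_colourInvariant (L := L) hs0 hs hΩm hΩinv (W := fun _ _ => (1 : ℝ)) (fun _ => measurable_const) (fun _ _ _ => rfl)
    hC hκ0 hκ₀ hκ hκ₂ hZ0 hτZ ?_
  filter_upwards [h] with β hβ u u' hu hu'
  rw [← boKernel_eq_fpBOKernel_one β (hΩm β) (hCΩ β) (hΩinv β)]
  exact hβ u u' hu hu'

end Summit.QuantumFields.YangMills.Theorems.TwistedTraceScaling.Negative.R38b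

end
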